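import Literature.MathematicalPhysics.QuantumLattice.PlaquettePairCouplings
import HarnessLib

/-!
# Crux `DressHalfFilled` (stmt-HubbardSuperconductivity-8148, route `LevyLogBootstrap`; shared with route
# `AnisotropyChord`): the two-plaquette Kato kernel as a sum over the SIXTEEN bond quadruples

Support file (`--supports stmt-HubbardSuperconductivity-8148`) for STUB 1 `stub_plaquetteData`, clause (W1). The kernel
`plaquetteKernel U κ' κ = interClusterKernel hH (plaquetteStates U) (bondHopping plaquetteBonds) κ' κ`
(`PlaquettePairCouplings`, `ClusterPairBosonCouplings`) is, by definition, a sum over ALL orbital quadruples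
`(i, j, i', j') ∈ (Orb PlaquetteSite)⁴` (`8⁴ = 4096` terms) weighted by `W i j · W i' j'`,
`W = bondHopping plaquetteBonds` (`= 1` iff `i, j` carry the same spin and `(site i, site j)` is one of the two
inter-plaquette bonds `((1,y), (0,y))`, `y = 0, 1`; else `0`). This file performs the bookkeeping every evaluation of
`J(U), V(U)` starts with:

* `sum_bondHopping_plaquetteBonds` — `Σ_{i,j} W(i,j) G(i,j) = Σ_{y,σ} G(c-orbital (1,y)σ, c-orbital (0,y)σ)` for any `G`;
* `plaquetteKernel_eq_sum_bondQuadruples` — `plaquetteKernel U κ' κ` equals the sum over the sixteen bond quadruples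
  `(y, σ, y', σ')` of the four `pairResolvent` terms of `interClusterKernel` (pair transfer `+ +`, out-and-back `- -`)
  with the explicit orbitals `i = (1,y)σ`, `j = (0,y)σ`, `i' = (1,y')σ'`, `j' = (0,y')σ'`.

Sources: W.-F. Tsai, S. A. Kivelson, PRB 73 (2006) 214510, App. A (A1); H. Yao, W.-F. Tsai, S. A. Kivelson, PRB 76 (2007)
161104, Fig. 1 (the two dashed bonds). Pure bookkeeping over tree definitions; no definition and no named fact is introduced.
-/

noncomputable section

set_option linter.dupNamespace false

namespace Summit.HubbardSuperconductivity.HubbardSuperconductivity.Theorems.LevyLogBootstrap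

open Matrix Finset Literature.MathematicalPhysics.QuantumLattice Literature.Probability.LatticeModels
open scoped ComplexOrder

/-! ### The two inter-plaquette bonds as an injective image -/

/-- The bond-orbital pair `((1,y)σ, (0,y)σ)` indexed by `(y, σ) ∈ Fin 2 × Fin 2`. (A local abbreviation inside
statements is avoided: the map is written out where used.) The map is injective. [folklore] -/
theorem bondOrbPair_injective :
    Function.Injective (fun q : Fin 2 × Fin 2 =>
      ((orb (toLex ![1, q.1]) q.2 : Orb PlaquetteSite), (orb (toLex ![0, q.1]) q.2 : Orb PlaquetteSite))) := by
  rintro ⟨y, σ⟩ ⟨y', σ'⟩ h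
  simp only [Prod.mk.injEq] at h
  obtain ⟨h1, -⟩ := h
  have h1' := congrArg ofLex h1
  simp only [orb, ofLex_toLex, Prod.mk.injEq] at h1'
  obtain ⟨hs, hσ⟩ := h1'
  have hy : y = y' := by
    have := congrFun (toLex.injective hs) 1
    simpa using this
  subst hy; subst hσ; rfl

/-- Membership in `plaquetteBonds`: exactly the two pairs `((1,y),(0,y))`. [folklore] -/
theorem mem_plaquetteBonds_iff (x z : PlaquetteSite) :
    (x, z) ∈ plaquetteBonds ↔ ∃ y : Fin 2, x = toLex ![1, y] ∧ z = toLex ![0, y] := by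
  simp only [plaquetteBonds, Finset.mem_insert, Finset.mem_singleton, Prod.mk.injEq]
  constructor
  · rintro (⟨rfl, rfl⟩ | ⟨rfl, rfl⟩)
    · exact ⟨0, rfl, rfl⟩
    · exact ⟨1, rfl, rfl⟩
  · rintro ⟨y, rfl, rfl⟩
    fin_cases y
    · exact Or.inl ⟨rfl, rfl⟩
    · exact Or.inr ⟨rfl, rfl⟩

/-- **Reduction of a bond-weighted double orbital sum to the four bond orbitals.** For every `G`,
`Σ_{i,j} bondHopping plaquetteBonds i j · G i j = Σ_{y,σ} G ((1,y)σ) ((0,y)σ)`. [folklore] -/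
theorem sum_bondHopping_plaquetteBonds (G : Orb PlaquetteSite → Orb PlaquetteSite → ℂ) :
    ∑ i : Orb PlaquetteSite, ∑ j : Orb PlaquetteSite, ((bondHopping plaquetteBonds i j : ℝ) : ℂ) * G i j =
      ∑ y : Fin 2, ∑ σ : Fin 2, G (orb (toLex ![1, y]) σ) (orb (toLex ![0, y]) σ) := by
  classical
  set e : Fin 2 × Fin 2 → Orb PlaquetteSite × Orb PlaquetteSite :=
    fun q => ((orb (toLex ![1, q.1]) q.2 : Orb PlaquetteSite), orb (toLex ![0, q.1]) q.2) with he
  have hinj : Function.Injective e := bondOrbPair_injective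
  -- the support condition of the weight, and its identification with the image of `e`
  have hC : ∀ x : Orb PlaquetteSite × Orb PlaquetteSite,
      ((ofLex x.1).2 = (ofLex x.2).2 ∧ ((ofLex x.1).1, (ofLex x.2).1) ∈ plaquetteBonds) ↔ ∃ q, x = e q := by
    intro x
    rw [mem_plaquetteBonds_iff]
    constructor
    · rintro ⟨hspin, y, hx, hz⟩
      refine ⟨(y, (ofLex x.1).2), ?_⟩
      rw [he]
      refine Prod.ext ?_ ?_
      · calc x.1 = toLex (ofLex x.1) := (toLex_ofLex x.1).symm
          _ = toLex ((ofLex x.1).1, (ofLex x.1).2) := rfl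
          _ = orb (toLex ![1, y]) (ofLex x.1).2 := by rw [hx]
      · calc x.2 = toLex (ofLex x.2) := (toLex_ofLex x.2).symm
          _ = toLex ((ofLex x.2).1, (ofLex x.2).2) := rfl
          _ = orb (toLex ![0, y]) (ofLex x.1).2 := by rw [hz, hspin]
    · rintro ⟨⟨y, σ⟩, rfl⟩
      exact ⟨rfl, y, rfl, rfl⟩
  -- as a sum over pairs, then over the filtered set, then over the image
  have h1 : ∑ i : Orb PlaquetteSite, ∑ j : Orb PlaquetteSite, ((bondHopping plaquetteBonds i j : ℝ) : ℂ) * G i j =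
      ∑ x ∈ (Finset.univ : Finset (Orb PlaquetteSite × Orb PlaquetteSite)),
        if (ofLex x.1).2 = (ofLex x.2).2 ∧ ((ofLex x.1).1, (ofLex x.2).1) ∈ plaquetteBonds then G x.1 x.2 else 0 := by
    rw [← Finset.univ_product_univ, Finset.sum_product]
    refine Finset.sum_congr rfl fun i _ => Finset.sum_congr rfl fun j _ => ?_
    unfold bondHopping
    split_ifs <;> simp
  rw [h1, ← Finset.sum_filter]
  have hS : (Finset.univ : Finset (Orb PlaquetteSite × Orb PlaquetteSite)).filter
      (fun x => (ofLex x.1).2 = (ofLex x.2).2 ∧ ((ofLex x.1).1, (ofLex x.2).1) ∈ plaquetteBonds) =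
      (Finset.univ : Finset (Fin 2 × Fin 2)).image e := by
    ext x
    simp only [Finset.mem_filter, Finset.mem_univ, true_and, Finset.mem_image]
    rw [hC]
    simp only [eq_comm]
  rw [hS, Finset.sum_image fun q _ q' _ h => hinj h, ← Finset.univ_product_univ, Finset.sum_product]

/-! ### The kernel as a sum over the sixteen bond quadruples -/

/-- **`plaquetteKernel` over the sixteen bond quadruples.** With `hH = plaquetteHamiltonian_isHermitian U`,
`φ = plaquetteStates U`, `E = (pairEnergy κ + pairEnergy κ')/2` and the orbitals `i = (1,y)σ`, `j = (0,y)σ`, `i' = (1,y')σ'`,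
`j' = (0,y')σ'`, the kernel `plaquetteKernel U κ' κ` is the sum over `(y, σ, y', σ') ∈ (Fin 2)⁴` of the four pair-resolvent
terms of `interClusterKernel` (the two pair-transfer orderings with `+`, the two out-and-back orderings with `-`).
Tsai–Kivelson 2006, App. A (A1). [folklore] -/
theorem plaquetteKernel_eq_sum_bondQuadruples (U : ℝ) (κ' κ : Fin 2 × Fin 2) :
    plaquetteKernel U κ' κ =
      ∑ y : Fin 2, ∑ σ : Fin 2, ∑ y' : Fin 2, ∑ σ' : Fin 2,
        (pairResolvent (plaquetteHamiltonian_isHermitian U)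
            ((pairEnergy (plaquetteHamiltonian U) (plaquetteStates U) κ +
              pairEnergy (plaquetteHamiltonian U) (plaquetteStates U) κ') / 2)
            (creation (orb (toLex ![1, y']) σ') *ᵥ plaquetteStates U κ'.1)
            (annihilation (orb (toLex ![1, y]) σ) *ᵥ plaquetteStates U κ.1)
            (annihilation (orb (toLex ![0, y']) σ') *ᵥ plaquetteStates U κ'.2)
            (creation (orb (toLex ![0, y]) σ) *ᵥ plaquetteStates U κ.2) +
          pairResolvent (plaquetteHamiltonian_isHermitian U)
            ((pairEnergy (plaquetteHamiltonian U) (plaquetteStates U) κ +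
              pairEnergy (plaquetteHamiltonian U) (plaquetteStates U) κ') / 2)
            (annihilation (orb (toLex ![1, y']) σ') *ᵥ plaquetteStates U κ'.1)
            (creation (orb (toLex ![1, y]) σ) *ᵥ plaquetteStates U κ.1)
            (creation (orb (toLex ![0, y']) σ') *ᵥ plaquetteStates U κ'.2)
            (annihilation (orb (toLex ![0, y]) σ) *ᵥ plaquetteStates U κ.2) -
          pairResolvent (plaquetteHamiltonian_isHermitian U)
            ((pairEnergy (plaquetteHamiltonian U) (plaquetteStates U) κ +
              pairEnergy (plaquetteHamiltonian U) (plaquetteStates U) κ') / 2)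
            (annihilation (orb (toLex ![1, y']) σ') *ᵥ plaquetteStates U κ'.1)
            (annihilation (orb (toLex ![1, y]) σ) *ᵥ plaquetteStates U κ.1)
            (creation (orb (toLex ![0, y']) σ') *ᵥ plaquetteStates U κ'.2)
            (creation (orb (toLex ![0, y]) σ) *ᵥ plaquetteStates U κ.2) -
          pairResolvent (plaquetteHamiltonian_isHermitian U)
            ((pairEnergy (plaquetteHamiltonian U) (plaquetteStates U) κ +
              pairEnergy (plaquetteHamiltonian U) (plaquetteStates U) κ') / 2)
            (creation (orb (toLex ![1, y']) σ') *ᵥ plaquetteStates U κ'.1)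
            (creation (orb (toLex ![1, y]) σ) *ᵥ plaquetteStates U κ.1)
            (annihilation (orb (toLex ![0, y']) σ') *ᵥ plaquetteStates U κ'.2)
            (annihilation (orb (toLex ![0, y]) σ) *ᵥ plaquetteStates U κ.2)) := by
  unfold plaquetteKernel interClusterKernel
  -- split the weight `W i j * W i' j'` and reduce the outer and the inner double sums
  have hsplit : ∀ (i j i' j' : Orb PlaquetteSite),
      (((bondHopping plaquetteBonds i j * bondHopping plaquetteBonds i' j' : ℝ)) : ℂ) =
        ((bondHopping plaquetteBonds i j : ℝ) : ℂ) * ((bondHopping plaquetteBonds i' j' : ℝ) : ℂ) := by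
    intro i j i' j'; push_cast; ring
  simp only [hsplit, mul_assoc]
  simp only [← Finset.mul_sum]
  rw [sum_bondHopping_plaquetteBonds]
  refine Finset.sum_congr rfl fun y _ => Finset.sum_congr rfl fun σ _ => ?_
  rw [sum_bondHopping_plaquetteBonds]
  -- the two sides now differ only in the (subsingleton) `DecidableEq` instance hidden in `pairResolvent`
  congr!

/-! ### Registered sub-goal of the crux item (stmt-HubbardSuperconductivity-8148) -/

set_option linter.style.longLine false in
/-- Registered sub-goal `dressHalfFilled_bondSumReduction` of the crux item (closed restatement of
`sum_bondHopping_plaquetteBonds`). [folklore] -/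
theorem dressHalfFilled_bondSumReduction : ∀ G : Literature.MathematicalPhysics.QuantumLattice.Orb Literature.MathematicalPhysics.QuantumLattice.PlaquetteSite → Literature.MathematicalPhysics.QuantumLattice.Orb Literature.MathematicalPhysics.QuantumLattice.PlaquetteSite → ℂ, (∑ i : Literature.MathematicalPhysics.QuantumLattice.Orb Literature.MathematicalPhysics.QuantumLattice.PlaquetteSite, ∑ j : Literature.MathematicalPhysics.QuantumLattice.Orb Literature.MathematicalPhysics.QuantumLattice.PlaquetteSite, ((Literature.MathematicalPhysics.QuantumLattice.bondHopping Literature.MathematicalPhysics.QuantumLattice.plaquetteBonds i j : ℝ) : ℂ) * G i j) = ∑ y : Fin 2, ∑ σ : Fin 2, G (Literature.MathematicalPhysics.QuantumLattice.orb (toLex ![1, y]) σ) (Literature.MathematicalPhysics.QuantumLattice.orb (toLex ![0, y]) σ) :=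
  fun G => sum_bondHopping_plaquetteBonds G

end Summit.HubbardSuperconductivity.HubbardSuperconductivity.Theorems.LevyLogBootstrap

end
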